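import Summits.QuantumFields.YangMills.Theorems.ComplexCouplingChannelComplexStrongCouplingAnchor
import Summits.QuantumFields.YangMills.Theorems.ComplexCouplingChannelFreeEnergyWindowChannelStubEnvelopeCriterion
import Summits.QuantumFields.YangMills.Theorems.ComplexCouplingChannelFreeEnergyWindowChannelStubGrowth
import Summits.QuantumFields.YangMills.Theorems.ComplexCouplingChannelFreeEnergyWindowChannelStubLogEnvelope
import Summits.QuantumFields.YangMills.Theorems.ComplexCouplingChannelFreeEnergyWindowChannelStubLocalRePart
import Summits.QuantumFields.YangMills.Theorems.ComplexCouplingChannelFreeEnergyWindowChannelStubReChain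
import Summits.QuantumFields.YangMills.Theorems.ComplexCouplingChannelFreeEnergyWindowChannelStubLocalWindowOfCauchy
import Summits.QuantumFields.YangMills.Theorems.ComplexCouplingChannelFreeEnergyWindowChannelStubPatchLocalWindows
import Summits.QuantumFields.YangMills.Theorems.ComplexCouplingChannelFreeEnergyWindowChannelTransportCriterion
import Summits.QuantumFields.YangMills.Theorems.ComplexCouplingChannelFreeEnergyWindowChannelTorusZeroFreeRegime
import Summits.QuantumFields.YangMills.Theorems.ComplexCouplingChannelFreeEnergyWindowChannelStubZeroFreeOfDerivBounds
import Literature.MathematicalPhysics.QuantumFieldTheory.WilsonFinTorusPartitionComplex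
import Summits.QuantumFields.YangMills.Theorems.ConvexGribovBodyNonSimplyConnectedLatticeGapAdmissibleInstance
import Summits.QuantumFields.YangMills.Theorems.FreeEnergyWindowChannel.Negative.TorusRemainderRigidity
import Summits.QuantumFields.YangMills.Theorems.FreeEnergyWindowChannel.Negative.TorusRemainderRigidityAt
import Summits.QuantumFields.YangMills.Theorems.FreeEnergyWindowChannel.Negative.FreeEnergyWindowChannelFalseOfSo3TorusRemainderNonvanishing
import Summits.QuantumFields.YangMills.Theorems.ComplexCouplingChannelFreeEnergyWindowChannelStubTransportAt
import Summits.QuantumFields.YangMills.Theorems.ComplexCouplingChannelFreeEnergyWindowChannelStubExpDecayOnCompacts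
import Summits.QuantumFields.YangMills.Theorems.ComplexCouplingChannelFreeEnergyWindowChannelStubExpWindowAt
import Summits.QuantumFields.YangMills.Theorems.ComplexCouplingChannelFreeEnergyWindowChannelStubFreeEnergyAnalytic
import Summits.QuantumFields.YangMills.Theorems.ComplexCouplingChannelFreeEnergyWindowChannelStubReachOfCrux
import Summits.QuantumFields.YangMills.Theorems.ComplexCouplingChannelFreeEnergyWindowChannelStubCumulantRadiusOfCrux
import Summits.QuantumFields.YangMills.Theorems.ComplexCouplingChannelFreeEnergyWindowChannelStructure

/-!
# Line `Sketch` (idea `log-envelope-transport`) for crux `FreeEnergyWindowChannel` (stmt-QuantumFields-18842)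

Lead skeleton of the TRANSPORT line (prover-line-stmt-QuantumFields-18842-c1-0, 2026-08-17; continued by lead c2,
prover-line-stmt-QuantumFields-18842-c2-0, and lead c3, prover-line-stmt-QuantumFields-18842-c3-0).
v12 (lead c3) — LAYER 6 LANDED: Y1 `stub_reach_of_crux` p162601 (wave 5), Y2 `stub_cumulantRadius_of_crux` p162813 (wave 5),
compositions `Theorems/…FreeEnergyWindowChannelStructure.lean` p163100 (crux ⇔ ExpWindow; real-β exponential remainder; weak-H negative
lemma; crux ⇔ REACH ∧ LOCAL ⇔ REACH ∧ K) and `Theorems/…LocalIffCumulantRadius.lean` (LOCAL ⇔ K, landing).  Sorries = the three PHYSICS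
stubs T / R / K only; every analysis statement of layers 1–6 is a tree theorem, and T, ExpWindow, REACH ∧ LOCAL, REACH ∧ K are
kernel-proved EQUIVALENT forms of the crux.
v11 (lead c3) — LAYER 5 LANDED: X1 `stub_expDecayOnCompacts` p161803 (wave 4), X2 `stub_expWindowAt` p162102 (lead), X4
`stub_freeEnergyAnalytic` p161927 (wave 4); the three stubs below are now tree copies.  LAYER 6 added: the regime split of
layer 2 is LOSSLESS — crux ⇒ REACH (`stub_reach_of_crux`, wave 5), crux ⇒ LOCAL (proved here), crux ⇒ CUMULANT RADIUS
(`stub_cumulantRadius_of_crux`, wave 5: bounded window ⇒ Borel–Carathéodory ⇒ Cauchy estimates, real/complex derivative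
bookkeeping), hence crux ⇔ REACH ∧ LOCAL ⇔ REACH ∧ K (compositions `freeEnergyWindowChannel_iff_reach_and_local`,
`freeEnergyWindowChannel_iff_reach_and_cumulantRadius`).
v10 (lead c3) — LAYER 5 added: SELF-IMPROVEMENT of the window.  The crux's bounded window `≤ M` is automatically
EXPONENTIALLY THIN: crux ⇔ ExpWindowChannel (`|log ‖Z_P z‖ + P⁴ Re f z| ≤ e^{-cP}` on the channel) — the anchor's pinning
`C P⁴ e^{-cP}` is carried along the channel by `stub_reChain` with exponent uniform on compacts, and channels shrink to
compactly contained sub-channels (`stub_connectedCompactJoin`).  Registered analysis stubs: `stub_expDecayOnCompacts`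
(abstract engine with rate; wave 4), `stub_expWindowAt` (pointwise crux-side composition; lead), `stub_freeEnergyAnalytic`
(crux ⇒ the bulk free-energy density exists and is real-analytic on `[β₁, ∞)`; wave 4).  Consequences (sorry-free modulo
those): `freeEnergyWindowChannel_iff_expWindowChannel`, the real-coupling exponential remainder
`expTorusRemainder_of_freeEnergyWindowChannel` (= the torus input of the route's HarmonicMeasureEngine, stmt-18844, paid by
THIS crux alone) and the negative lemma with the weaker hypothesis "remainder not exponentially small".
v9 (lead c2) — EVERYTHING OF LAYERS 3–4 LANDED: N p158505, TA p158996 (wave 3), RA p159389, negative lemma p159230 (ACCEPTED,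
async audit).  Sorries = the three PHYSICS stubs T / R / K only; T and R are physics-false at (SO(3), r) by the invariant, open for
simply connected G.
v8 (lead c2) — STUB N LANDED (p158505) and STUB TA LANDED (p158996, wave 3); the negative lemma
`FreeEnergyWindowChannel_false_of_So3TorusRemainderNonvanishing` proposed `--negative-modulo` (p159230, review-queued: new def H);
STUB RA proved (`work/stubs/stub_rigidityAt.lean`, landing).  Sorries = T, R, K (physics) + RA (landing).
v7 (lead c2) — LAYER 4 added: POINTWISE forms `stub_transportAt` (wave 3) / `stub_rigidityAt` (lead) at fixed `(G, r, β)`,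
so that any binder repair of the crux (e.g. `[SimplyConnectedSpace G]`) inherits the transport and the rigidity verbatim
(`windowAt_iff_torusZeroFreeAt`, `freeEnergyWindowChannelSC_of_torusZeroFreeSC`).
v6 (lead c2) — LAYER 3 added: the NEGATION HALF of the k2 sketch.  The symmetric-torus remainder
`log Z_P(β) + P⁴ F` is a TRANSPORT INVARIANT: `stub_torusRemainderRigidity` (analysis; PROVED sorry-free in
`work/TorusRemainderRigidity.lean`, landing as `Theorems/FreeEnergyWindowChannel/Negative/TorusRemainderRigidity.lean`):
crux ∧ proved anchor ⇒ for every admissible `(G, r)`, beyond `β₁`, at every real `β ≥ β₁` some real `F` has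
`log Z(β;P⁴) + P⁴ F → 0` (Archimedean pinning `Re f = Re f_A` on the overlap with the anchor disc + the landed real-part
two-constants chain `stub_reChain` at `{β}`).  Hence the crux is FALSE modulo the real-coupling physics hypothesis
`So3TorusRemainderNonvanishing` ('t Hooft magnetic-flux degeneracy of `SO(3) = SU(2)/ℤ₂` lattice gauge theory: torus constant
`κ = log 8 ≠ 0` at weak coupling vs the PROVED `κ = 0` on the strong-coupling disc; `SO(3)` is admissible in the tree,
`isCompactSimpleLieGroup_SO3`): `not_FreeEnergyWindowChannel_of_So3TorusRemainderNonvanishing` below, landing as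
`Theorems/FreeEnergyWindowChannel/Negative/FreeEnergyWindowChannelFalseOfSo3TorusRemainderNonvanishing.lean`
(`--negative-modulo`).  Consequence for the physics stubs: T / R (and regime-cut S3) are physics-FALSE at `(SO(3), r)`; for
simply connected `G` they remain the honest open residual — suggested repair of the ∀G crux: `[SimplyConnectedSpace G]`.
v5 — layer 2's analysis LANDED: bridge `stub_zeroFreeOfDerivBounds` (p156412, `Theorems/…StubZeroFreeOfDerivBounds.lean`, wave 2)
and regime glue `stub_torusZeroFreeRegime` (p156480, `Theorems/…TorusZeroFreeRegime.lean`); EVERY analysis declaration of the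
line is a tree theorem; the skeleton's only sorries are PHYSICS: `stub_torusZeroFree` (T ≡ crux) for layer 1, or
`stub_torusZeroFreeReach` (global) + `stub_cumulantRadius` (weak coupling, real-variable) for layer 2.
v4 — LAYER 2 added (optional regime form of the physics stub T): T ⟸ `stub_torusZeroFreeReach` (physics, global) ∧ a LOCAL
zero-free disc at every large real coupling, glued by `stub_torusZeroFreeRegime` (plane topology, PROVED in
`work/TorusZeroFreeRegime.lean`, landing); the local piece in REAL-VARIABLE form `stub_cumulantRadius` (physics, weak
coupling: volume-uniform geometric growth of the cumulants of the Wilson action under the Gibbs measure at real coupling)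
through the analysis bridge `stub_zeroFreeOfDerivBounds` (Taylor series + identity theorem; wave 2).
v3 — the transport criterion `stub_transportCriterion` (crux ⇔ T) LANDED (p155289,
`Theorems/ComplexCouplingChannelFreeEnergyWindowChannelTransportCriterion.lean`); the skeleton's only sorry is the physics
stub `stub_torusZeroFree`, kernel-equivalent to the crux.
v2 — wave 1 LANDED all six analysis stubs (p154263 `stub_growth`, p154292 `stub_logEnvelope`, p154208
`stub_localRePart`, p154566 `stub_reChain`, p154424 `stub_localWindowOfCauchy`, p154404 `stub_patchLocalWindows`, files
`Theorems/ComplexCouplingChannelFreeEnergyWindowChannelStub*.lean`, namespace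
`Summit.QuantumFields.YangMills.Theorems.FreeEnergyWindowChannel`); the composition T ⇒ E ⇒ crux is proved sorry-free in
`work/TransportCriterion.lean` (theorems `envelope_of_torusZeroFree`, `torusZeroFree_of_crux`,
`freeEnergyWindowChannel_iff_torusZeroFree`) and is registered here as the stub `stub_transportCriterion` (crux ⇔ T) so
that it can land `--supports`; the ONLY open content is the physics stub `stub_torusZeroFree` (T), now KERNEL-PROVED
EQUIVALENT to the crux.  v1 (7 stubs, 10:10Z) is the item evidence `FreeEnergyWindowChannel.lean` of 10:12Z.

The crux (route `ComplexCouplingChannel`, rank 3): for every compact simple `G` and faithful unitary `r`, beyond some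
`β₁`, every real coupling `β ≥ β₁` is joined to the strong-coupling anchor by an open connected complex-coupling channel
on which the symmetric-torus Wilson partition functions `Z_P(z) = wilsonFinTorusPartitionC r.ρ z P P P P` (`P ≥ P₀`)
are zero-free with a BOUNDED continuation of the finite-size free energy, `|log ‖Z_P z‖ + P⁴ Re f z| ≤ M`, ONE analytic
`f`.

THE LINE.  The `∃ f … ≤ M` clause is OUTPUT: the crux follows from (indeed is equivalent to) symmetric-torus
ZERO-FREENESS alone (`stub_torusZeroFree` = the crux with that clause deleted), given the PROVED anchor
`complexStrongCouplingAnchor_proof`.  Mechanism (group-blind one-variable analysis, all landed):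
* `stub_growth`: `‖Z_P(z)‖ ≤ exp (a P⁴ ‖z‖)` (`0 ≤ S ≤ 12 N P⁴`);
* `stub_logEnvelope`: a-priori envelope `|log ‖Z_P‖| ≤ A P⁴` on compact sub-channels (Borel–Carathéodory for local
  holomorphic logarithms along disc chains, from `Z_P 0 = 1`, zero-freeness, growth);
* `stub_localRePart` + `stub_reChain`: REAL-PART two-constants chain (Borel–Carathéodory + Hadamard three circles per
  bead, exponent uniform in the function, finite subcover) applied to `u = P⁻⁴ log ‖Z_P‖ − Q⁻⁴ log ‖Z_Q‖` (`≤ 2A` on the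
  sub-channel, `≤ C'(e^{-cP} + e^{-cQ})` on the anchor disc): `(P⁻⁴ log ‖Z_P‖)_P` is uniformly Cauchy with rate
  `e^{-cθP}` — the anchor's exponential pinning, carried by harmonic measure, beats the polynomial envelope `P⁴`;
* `stub_localWindowOfCauchy`: local holomorphic limits ⇒ local windows (`M = O(P⁴ e^{-cθP}) = O(1)`);
* `stub_patchLocalWindows`: local windows patch along a disc chain into ONE holomorphic `f` on an open connected
  `U ∋ 0, β`; normalising `f 0 = 0` gives the pure envelope statement E, and the landed criterion
  `stub_envelopeCriterion.2` (E ⇒ crux) closes the crux by name.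
Disproof.lean (cdisprove v2, read 09:55Z and 10:40Z): its witness-rigidity lemmas constrain window witnesses `f`, which
this line no longer posits; `-- Targets: none`.  Barriers: the analysis is group-blind (implications); U(1)₄ / ℤ_N
failures sit inside `stub_torusZeroFree`, where `IsCompactSimpleLieGroup` is available.
-/

open MeasureTheory Complex Metric Set Filter Topology

namespace Summit.QuantumFields.YangMills.Cruxes.FreeEnergyWindowChannel.Transport

/-- STUB T (physics; the non-abelian input; difficulty: open-problem; KERNEL-EQUIVALENT to the crux by
`stub_transportCriterion`).  `TorusZeroFreeChannel`: the crux with its `∃ f, … ≤ M` clause deleted — for every compact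
simple `G` and faithful unitary `r`, beyond some `β₁`, for every `β ≥ β₁` and `ρ > 0` there is an open connected `D ∋ β`
with a real point `x ∈ D`, `|x| < ρ`, and `P₀` such that the symmetric-torus Wilson partition functions `Z_P`, `P ≥ P₀`,
have no zeros on `D`.  `U(1)₄`-false in intent (Fisher zeros pinch the axis at `β_c ≈ 1.01`), `ℤ_N`-false (freezing
transitions); no non-abelian Lee–Yang / Fisher-zero location theorem exists beyond the strong-coupling disc. -/
theorem stub_torusZeroFree :
    ∀ (G : Type) [Group G] [TopologicalSpace G] [IsTopologicalGroup G] [CompactSpace G] [MeasurableSpace G] [BorelSpace G], Literature.MathematicalPhysics.QuantumFieldTheory.IsCompactSimpleLieGroup G → ∀ r : Literature.MathematicalPhysics.QuantumFieldTheory.LatticeRep G,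
    ∃ β₁ : ℝ, ∀ β : ℝ, β₁ ≤ β → ∀ ρ : ℝ, 0 < ρ →
      ∃ D : Set ℂ, IsOpen D ∧ IsConnected D ∧ (β : ℂ) ∈ D ∧ (∃ x : ℝ, |x| < ρ ∧ (x : ℂ) ∈ D) ∧
        ∃ P₀ : ℕ, ∀ P : ℕ, P₀ ≤ P → ∀ z ∈ D,
          Literature.MathematicalPhysics.QuantumFieldTheory.wilsonFinTorusPartitionC r.ρ z P P P P ≠ 0 := by
  sorry

/-! CRITERION `stub_transportCriterion : crux ↔ T` LANDED (p155289, `Theorems/…TransportCriterion.lean`, with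
`envelope_of_torusZeroFree` (T ⇒ E), `torusZeroFree_of_crux`, `freeEnergyWindowChannel_iff_torusZeroFree`), namespace
`Summit.QuantumFields.YangMills.Theorems.FreeEnergyWindowChannel`; imported above and used by name below. -/

/-- COMPOSITION: the crux BY NAME from the physics stub through the transport criterion. -/
theorem FreeEnergyWindowChannel_of :
    Summit.QuantumFields.YangMills.Theses.ComplexCouplingChannel.FreeEnergyWindowChannel :=
  Summit.QuantumFields.YangMills.Theorems.FreeEnergyWindowChannel.stub_transportCriterion.2 stub_torusZeroFree

/-! ## Layer 2 (optional): T by coupling regime; the weak-coupling piece in real-variable (cumulant) form -/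

/-- STUB R (physics; global; the non-abelian input; difficulty: open-problem).  REACH, zero-freeness only: for every
threshold `b` some real `βs ≥ b` is joined to `0` by an open connected channel `D` on which the symmetric-torus partition
functions `Z_P`, `P ≥ P₀`, have no zeros (the channel may detour through `ℂ` around bulk first-order lines; it must pass
UNDER the crossover Fisher zeros, height ≈ 0.15 for `SU(2)` on `4⁴–6⁴`).  Zero-freeness-only shadow of regime-cut's
`stub_anchorReachesWeakCoupling` and of the v7 envelope line's `stub_reachEnvelope`; `U(1)₄`-false in intent. -/
theorem stub_torusZeroFreeReach :
    ∀ (G : Type) [Group G] [TopologicalSpace G] [IsTopologicalGroup G] [CompactSpace G] [MeasurableSpace G] [BorelSpace G], Literature.MathematicalPhysics.QuantumFieldTheory.IsCompactSimpleLieGroup G → ∀ r : Literature.MathematicalPhysics.QuantumFieldTheory.LatticeRep G,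
    ∀ b : ℝ, ∃ βs : ℝ, b ≤ βs ∧ ∃ D : Set ℂ, IsOpen D ∧ IsConnected D ∧ (0 : ℂ) ∈ D ∧ ((βs : ℝ) : ℂ) ∈ D ∧
      ∃ P₀ : ℕ, ∀ P : ℕ, P₀ ≤ P → ∀ z ∈ D,
        Literature.MathematicalPhysics.QuantumFieldTheory.wilsonFinTorusPartitionC r.ρ z P P P P ≠ 0 := by
  sorry

/-- STUB K (physics; weak coupling; REAL coupling only; difficulty: open-problem).  CUMULANT RADIUS: beyond some `β₁`, at
every real coupling `t ≥ β₁` the derivatives of the finite-volume free energies `s ↦ log Z_ℝ(s; P⁴)` at `t` (up to sign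
the cumulants `κ_n` of the total Wilson action under the symmetric-torus Gibbs measure at coupling `t`) grow at most
geometrically in `n` with a rate `C` UNIFORM IN THE VOLUME: `|∂ⁿ log Z_P(t)| ≤ K_P · n! · Cⁿ` (`n ≥ 1`, `P ≥ P₀`, any
prefactor `K_P`).  Equivalent to a volume-uniform lower bound `1/C` on the analyticity radius of the finite-volume free
energy at `t`, i.e. to a `P`-uniform zero-free complex disc around `t` (`stub_zeroFreeOfDerivBounds` gives ⇒); it is
what a convergent expansion of the free energy density with volume-uniform radius delivers (strong coupling: the tree's
cluster expansion; weak coupling: open — Bałaban's RG gives ultraviolet stability, not analyticity in `β`). -/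
theorem stub_cumulantRadius :
    ∀ (G : Type) [Group G] [TopologicalSpace G] [IsTopologicalGroup G] [CompactSpace G] [MeasurableSpace G] [BorelSpace G], Literature.MathematicalPhysics.QuantumFieldTheory.IsCompactSimpleLieGroup G → ∀ r : Literature.MathematicalPhysics.QuantumFieldTheory.LatticeRep G,
    ∃ β₁ : ℝ, ∀ t : ℝ, β₁ ≤ t → ∃ C : ℝ, 0 < C ∧ ∃ P₀ : ℕ, ∀ P : ℕ, P₀ ≤ P → ∃ K : ℝ, ∀ n : ℕ, 1 ≤ n →
      |iteratedDeriv n (fun s : ℝ =>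
          Real.log (Literature.MathematicalPhysics.QuantumFieldTheory.wilsonFinTorusPartition r.ρ s P P P P)) t| ≤
        K * n.factorial * C ^ n := by
  sorry

/-! BRIDGE `stub_zeroFreeOfDerivBounds` LANDED (p156412, `Theorems/…StubZeroFreeOfDerivBounds.lean`: an entire `Z`, real positive on
the real axis, with `|∂ⁿ log ‖Z‖ (t)| ≤ K n! Cⁿ`, `n ≥ 1`, has no zeros on `‖z − t‖ < 1/C`; local holomorphic logarithm,
`Complex.taylorSeries_eq_on_ball'`, `FormalMultilinearSeries.ofScalars`, identity theorem) and REGIME GLUE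
`stub_torusZeroFreeRegime` LANDED (p156480, `Theorems/…TorusZeroFreeRegime.lean`: REACH → LOCAL → T, zero-free open sets unite),
namespace `Summit.QuantumFields.YangMills.Theorems.FreeEnergyWindowChannel`; imported above and used by name below. -/

/-- LOCAL zero-free discs from the cumulant radius (sorry-free modulo the physics stub `stub_cumulantRadius`):
at real `s` the complex partition function is the real one, which is positive
(`wilsonFinTorusPartitionC_ofReal`, `wilsonFinTorusPartition_pos`), so `Z_P s = ‖Z_P s‖` and
`log ‖Z_P s‖ = log Z_ℝ(s; P⁴)`; the bridge gives the zero-free disc of radius `1/C` for every `P ≥ P₀`. -/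
theorem torusZeroFreeLocal_of_cumulantRadius :
    ∀ (G : Type) [Group G] [TopologicalSpace G] [IsTopologicalGroup G] [CompactSpace G] [MeasurableSpace G] [BorelSpace G], Literature.MathematicalPhysics.QuantumFieldTheory.IsCompactSimpleLieGroup G → ∀ r : Literature.MathematicalPhysics.QuantumFieldTheory.LatticeRep G,
      ∃ β₁ : ℝ, ∀ t : ℝ, β₁ ≤ t → ∃ δ : ℝ, 0 < δ ∧ ∃ P₀ : ℕ, ∀ P : ℕ, P₀ ≤ P → ∀ z ∈ Metric.ball ((t : ℝ) : ℂ) δ,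
        Literature.MathematicalPhysics.QuantumFieldTheory.wilsonFinTorusPartitionC r.ρ z P P P P ≠ 0 := by
  intro G _ _ _ _ _ _ hG r
  haveI : SecondCountableTopology G :=
    (r.continuous.isClosedEmbedding r.injective).isEmbedding.secondCountableTopology
  obtain ⟨β₁, hK⟩ := stub_cumulantRadius G hG r
  refine ⟨β₁, fun t ht => ?_⟩
  obtain ⟨C, hC, P₀, hP₀⟩ := hK t ht
  refine ⟨C⁻¹, inv_pos.2 hC, P₀, fun P hP z hz => ?_⟩
  obtain ⟨K, hKn⟩ := hP₀ P hP
  set Z : ℂ → ℂ := fun w =>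
    Literature.MathematicalPhysics.QuantumFieldTheory.wilsonFinTorusPartitionC r.ρ w P P P P with hZ
  have hZd : Differentiable ℂ Z :=
    Literature.MathematicalPhysics.QuantumFieldTheory.differentiable_wilsonFinTorusPartitionC r.ρ r.continuous P P P P
  have hnorm : ∀ s : ℝ, ‖Z (s : ℂ)‖ =
      Literature.MathematicalPhysics.QuantumFieldTheory.wilsonFinTorusPartition r.ρ s P P P P := fun s => by
    simp only [hZ, Literature.MathematicalPhysics.QuantumFieldTheory.wilsonFinTorusPartitionC_ofReal, Complex.norm_real,
      Real.norm_eq_abs]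
    exact abs_of_pos
      (Literature.MathematicalPhysics.QuantumFieldTheory.wilsonFinTorusPartition_pos r.continuous s P P P P)
  have hreal : ∀ s : ℝ, Z (s : ℂ) = ((‖Z (s : ℂ)‖ : ℝ) : ℂ) := fun s => by
    rw [hnorm s]
    simp only [hZ, Literature.MathematicalPhysics.QuantumFieldTheory.wilsonFinTorusPartitionC_ofReal]
  have hne : ∀ s : ℝ, Z (s : ℂ) ≠ 0 := fun s => by
    rw [hreal s, Ne, Complex.ofReal_eq_zero, hnorm s]
    exact (Literature.MathematicalPhysics.QuantumFieldTheory.wilsonFinTorusPartition_pos r.continuous s P P P P).ne'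
  have hder : ∀ n : ℕ, 1 ≤ n → |iteratedDeriv n (fun s : ℝ => Real.log ‖Z (s : ℂ)‖) t| ≤ K * n.factorial * C ^ n := by
    intro n hn
    have hfun : (fun s : ℝ => Real.log ‖Z (s : ℂ)‖) = fun s : ℝ =>
        Real.log (Literature.MathematicalPhysics.QuantumFieldTheory.wilsonFinTorusPartition r.ρ s P P P P) :=
      funext fun s => by rw [hnorm s]
    rw [hfun]
    exact hKn n hn
  have hzt : ‖z - (t : ℂ)‖ < C⁻¹ := by rwa [Metric.mem_ball, dist_eq_norm] at hz
  exact Summit.QuantumFields.YangMills.Theorems.FreeEnergyWindowChannel.stub_zeroFreeOfDerivBounds Z t C K hC hZd hreal hne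
    hder z hzt

/-- SECOND COMPOSITION (sorry-free apart from the two physics stubs it names): the crux BY NAME through the regime layer —
the landed glue `stub_torusZeroFreeRegime` fed with `stub_torusZeroFreeReach` and the local discs of
`torusZeroFreeLocal_of_cumulantRadius` (from `stub_cumulantRadius` through the landed bridge), then the transport criterion. -/
theorem FreeEnergyWindowChannel_of_regime :
    Summit.QuantumFields.YangMills.Theses.ComplexCouplingChannel.FreeEnergyWindowChannel :=
  Summit.QuantumFields.YangMills.Theorems.FreeEnergyWindowChannel.stub_transportCriterion.2
    (Summit.QuantumFields.YangMills.Theorems.FreeEnergyWindowChannel.stub_torusZeroFreeRegime stub_torusZeroFreeReach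
      torusZeroFreeLocal_of_cumulantRadius)


/-! ## Layer 3 (lead c2): the negation half — the torus remainder is a transport invariant -/

/-! STUB N `stub_torusRemainderRigidity` LANDED (p158505, `Theorems/FreeEnergyWindowChannel/Negative/TorusRemainderRigidity.lean`,
namespace `Summit.QuantumFields.YangMills.Theorems.FreeEnergyWindowChannel.Negative`, with the engine
`remainder_tendsto_zero_of_window_of_pinning`, `torusRemainder_tendsto_zero_of_freeEnergyWindowChannel`, the doubling form and the
contrapositives `not_freeEnergyWindowChannel_of_torusRemainder` / `_of_doublingRemainder`): TORUS-REMAINDER RIGIDITY — the crux (with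
the proved anchor) forces, for every admissible `(G, r)`, beyond some `β₁`, at every real `β ≥ β₁`, a real constant `F` with
`log Z(β; P⁴) + P⁴ F → 0`; imported above and used by name below. -/

/-- NEGATIVE COMPOSITION at a general admissible `(G, r)` (sorry-free; STUB N landed): if at arbitrarily large real
`β` the torus remainder fails to tend to `0` for EVERY real constant `F`, the crux is false. -/
theorem not_FreeEnergyWindowChannel_of_torusRemainder
    (G : Type) [Group G] [TopologicalSpace G] [IsTopologicalGroup G] [CompactSpace G] [MeasurableSpace G]
    [BorelSpace G] (hG : Literature.MathematicalPhysics.QuantumFieldTheory.IsCompactSimpleLieGroup G)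
    (r : Literature.MathematicalPhysics.QuantumFieldTheory.LatticeRep G)
    (hκ : ∀ b : ℝ, ∃ β : ℝ, b ≤ β ∧ ∀ F : ℝ,
      ¬ Filter.Tendsto (fun P : ℕ =>
          Real.log (Literature.MathematicalPhysics.QuantumFieldTheory.wilsonFinTorusPartition r.ρ β P P P P) +
            (P : ℝ) ^ 4 * F) Filter.atTop (nhds 0)) :
    ¬ Summit.QuantumFields.YangMills.Theses.ComplexCouplingChannel.FreeEnergyWindowChannel := by
  intro h
  obtain ⟨β₁, hβ₁⟩ :=
    Summit.QuantumFields.YangMills.Theorems.FreeEnergyWindowChannel.Negative.stub_torusRemainderRigidity h G hG r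
  obtain ⟨β, hb, hno⟩ := hκ β₁
  obtain ⟨F, hF⟩ := hβ₁ β hb
  exact hno F hF

/-- H (physics; REAL coupling; one lattice gauge theory; confinement grade — the hypothesis of the negative lemma,
expected TRUE): for some faithful unitary representation `r` of `SO(3)` (Borel σ-algebra), at arbitrarily large real
`β` the symmetric-torus remainder `log Z(β; P⁴) + P⁴ F` fails to tend to `0` for every real `F` (expected
`= log 8 + o(1)` at `F = f(β)`: eight degenerate `ℤ₂` magnetic-flux sectors of `SU(2)/ℤ₂` on `T⁴`). -/
def So3TorusRemainderNonvanishing : Prop :=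
  haveI : IsTopologicalGroup Literature.AlgebraicTopology.FundamentalGroup.SO3 :=
    Summit.QuantumFields.YangMills.Theorems.NonSimplyConnectedLatticeGap.so3_isTopologicalGroup
  haveI : CompactSpace Literature.AlgebraicTopology.FundamentalGroup.SO3 :=
    Summit.QuantumFields.YangMills.Theorems.NonSimplyConnectedLatticeGap.so3_compactSpace
  letI : MeasurableSpace Literature.AlgebraicTopology.FundamentalGroup.SO3 :=
    borel Literature.AlgebraicTopology.FundamentalGroup.SO3
  haveI : BorelSpace Literature.AlgebraicTopology.FundamentalGroup.SO3 := ⟨rfl⟩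
  ∃ r : Literature.MathematicalPhysics.QuantumFieldTheory.LatticeRep Literature.AlgebraicTopology.FundamentalGroup.SO3,
    ∀ b : ℝ, ∃ β : ℝ, b ≤ β ∧ ∀ F : ℝ,
      ¬ Filter.Tendsto (fun P : ℕ =>
          Real.log (Literature.MathematicalPhysics.QuantumFieldTheory.wilsonFinTorusPartition r.ρ β P P P P) +
            (P : ℝ) ^ 4 * F) Filter.atTop (nhds 0)

/-- THE NEGATIVE LEMMA (sorry-free; STUB N landed): `So3TorusRemainderNonvanishing → ¬ FreeEnergyWindowChannel`
(`SO(3)` is admissible: `isCompactSimpleLieGroup_SO3`). -/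
theorem not_FreeEnergyWindowChannel_of_So3TorusRemainderNonvanishing :
    So3TorusRemainderNonvanishing →
      ¬ Summit.QuantumFields.YangMills.Theses.ComplexCouplingChannel.FreeEnergyWindowChannel := by
  intro hH
  haveI : IsTopologicalGroup Literature.AlgebraicTopology.FundamentalGroup.SO3 :=
    Summit.QuantumFields.YangMills.Theorems.NonSimplyConnectedLatticeGap.so3_isTopologicalGroup
  haveI : CompactSpace Literature.AlgebraicTopology.FundamentalGroup.SO3 :=
    Summit.QuantumFields.YangMills.Theorems.NonSimplyConnectedLatticeGap.so3_compactSpace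
  letI : MeasurableSpace Literature.AlgebraicTopology.FundamentalGroup.SO3 :=
    borel Literature.AlgebraicTopology.FundamentalGroup.SO3
  haveI : BorelSpace Literature.AlgebraicTopology.FundamentalGroup.SO3 := ⟨rfl⟩
  obtain ⟨r, hr⟩ := hH
  exact not_FreeEnergyWindowChannel_of_torusRemainder _
    Summit.QuantumFields.YangMills.Theorems.NonSimplyConnectedLatticeGap.isCompactSimpleLieGroup_SO3 r hr


/-! ## Layer 4 (lead c2): POINTWISE forms — the transport and the rigidity at a fixed `(G, r, β)`

The landed criterion `stub_transportCriterion` and STUB N are stated for the crux's full binder prefix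
(`∀ G simple compact, ∀ r, ∃ β₁, ∀ β ≥ β₁`).  Their proofs are local in `(G, r, β)`; the pointwise forms below make that
explicit, so that ANY planner repair of the binder prefix (e.g. `[SimplyConnectedSpace G]`, suggested by layer 3)
inherits "window channel at β ⇔ zero-free channel at β" and "window channel at β ⇒ torus remainder at β → 0" verbatim. -/

/-! STUB TA `stub_transportAt` LANDED (p158996, wave 3, `Theorems/ComplexCouplingChannelFreeEnergyWindowChannelStubTransportAt.lean`,
namespace `Summit.QuantumFields.YangMills.Theorems.FreeEnergyWindowChannel`, with the normalised helper `window_of_torusZeroFreeAt`):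
POINTWISE TRANSPORT — at fixed `(G, r, β)`, zero-free channels at `β` for every `ρ` give window channels at `β` for every `ρ`;
imported above and used by name below. -/

/-! STUB RA `stub_rigidityAt` LANDED (p159389, `Theorems/FreeEnergyWindowChannel/Negative/TorusRemainderRigidityAt.lean`, namespace
`Summit.QuantumFields.YangMills.Theorems.FreeEnergyWindowChannel.Negative`, with `remainder_tendsto_zero_of_windowAt_of_anchor`):
POINTWISE RIGIDITY — at fixed `(G, r, β)`, window channels at `β` for every `ρ` force `∃ F, log Z(β; P⁴) + P⁴ F → 0`.
The NEGATIVE LEMMA LANDED too (p159230, `Theorems/FreeEnergyWindowChannel/Negative/FreeEnergyWindowChannelFalseOfSo3TorusRemainderNonvanishing.lean`,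
`--negative-modulo So3TorusRemainderNonvanishing`): `FreeEnergyWindowChannel_false_of_So3TorusRemainderNonvanishing`; the tree copies
are re-exported below under the skeleton's names. -/

/-- Pointwise rigidity, tree copy (p159389). -/
theorem rigidityAt_landed :
    ∀ (G : Type) [Group G] [TopologicalSpace G] [IsTopologicalGroup G] [CompactSpace G] [MeasurableSpace G] [BorelSpace G], Literature.MathematicalPhysics.QuantumFieldTheory.IsCompactSimpleLieGroup G → ∀ r : Literature.MathematicalPhysics.QuantumFieldTheory.LatticeRep G, ∀ β : ℝ,
      (∀ ρ : ℝ, 0 < ρ →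
        ∃ D : Set ℂ, IsOpen D ∧ IsConnected D ∧ (β : ℂ) ∈ D ∧ (∃ x : ℝ, |x| < ρ ∧ (x : ℂ) ∈ D) ∧
          ∃ f : ℂ → ℂ, DifferentiableOn ℂ f D ∧ ∃ M : ℝ, ∃ P₀ : ℕ, ∀ P : ℕ, P₀ ≤ P → ∀ z ∈ D,
            Literature.MathematicalPhysics.QuantumFieldTheory.wilsonFinTorusPartitionC r.ρ z P P P P ≠ 0 ∧
              |Real.log ‖Literature.MathematicalPhysics.QuantumFieldTheory.wilsonFinTorusPartitionC r.ρ z P P P P‖ +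
                (P : ℝ) ^ 4 * (f z).re| ≤ M) →
      ∃ F : ℝ, Filter.Tendsto (fun P : ℕ =>
        Real.log (Literature.MathematicalPhysics.QuantumFieldTheory.wilsonFinTorusPartition r.ρ β P P P P) +
          (P : ℝ) ^ 4 * F) Filter.atTop (nhds 0) :=
  fun G _ _ _ _ _ _ hG r β h =>
    Summit.QuantumFields.YangMills.Theorems.FreeEnergyWindowChannel.Negative.stub_rigidityAt G hG r β h

/-- The landed negative lemma, tree copy (p159230): the crux is false modulo the tree's `So3TorusRemainderNonvanishing`. -/
theorem FreeEnergyWindowChannel_false_of_H_landed :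
    Summit.QuantumFields.YangMills.Theorems.FreeEnergyWindowChannel.Negative.So3TorusRemainderNonvanishing →
      ¬ Summit.QuantumFields.YangMills.Theses.ComplexCouplingChannel.FreeEnergyWindowChannel :=
  Summit.QuantumFields.YangMills.Theorems.FreeEnergyWindowChannel.Negative.FreeEnergyWindowChannel_false_of_So3TorusRemainderNonvanishing

/-- POINTWISE CRITERION (sorry-free; STUB TA landed): at a fixed admissible `(G, r)` and real `β`, "zero-free channel at
`β` for every `ρ`" ⇔ "window channel at `β` for every `ρ`" (`←` deletes a conjunct). -/
theorem windowAt_iff_torusZeroFreeAt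
    (G : Type) [Group G] [TopologicalSpace G] [IsTopologicalGroup G] [CompactSpace G] [MeasurableSpace G]
    [BorelSpace G] (hG : Literature.MathematicalPhysics.QuantumFieldTheory.IsCompactSimpleLieGroup G)
    (r : Literature.MathematicalPhysics.QuantumFieldTheory.LatticeRep G) (β : ℝ) :
    (∀ ρ : ℝ, 0 < ρ →
        ∃ D : Set ℂ, IsOpen D ∧ IsConnected D ∧ (β : ℂ) ∈ D ∧ (∃ x : ℝ, |x| < ρ ∧ (x : ℂ) ∈ D) ∧
          ∃ f : ℂ → ℂ, DifferentiableOn ℂ f D ∧ ∃ M : ℝ, ∃ P₀ : ℕ, ∀ P : ℕ, P₀ ≤ P → ∀ z ∈ D,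
            Literature.MathematicalPhysics.QuantumFieldTheory.wilsonFinTorusPartitionC r.ρ z P P P P ≠ 0 ∧
              |Real.log ‖Literature.MathematicalPhysics.QuantumFieldTheory.wilsonFinTorusPartitionC r.ρ z P P P P‖ +
                (P : ℝ) ^ 4 * (f z).re| ≤ M) ↔
    (∀ ρ : ℝ, 0 < ρ →
        ∃ D : Set ℂ, IsOpen D ∧ IsConnected D ∧ (β : ℂ) ∈ D ∧ (∃ x : ℝ, |x| < ρ ∧ (x : ℂ) ∈ D) ∧
          ∃ P₀ : ℕ, ∀ P : ℕ, P₀ ≤ P → ∀ z ∈ D,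
            Literature.MathematicalPhysics.QuantumFieldTheory.wilsonFinTorusPartitionC r.ρ z P P P P ≠ 0) := by
  refine ⟨fun h ρ hρ => ?_, fun h =>
    Summit.QuantumFields.YangMills.Theorems.FreeEnergyWindowChannel.stub_transportAt G hG r β h⟩
  obtain ⟨D, hDo, hDc, hβD, hx, f, -, M, P₀, hwin⟩ := h ρ hρ
  exact ⟨D, hDo, hDc, hβD, hx, P₀, fun P hP z hz => (hwin P hP z hz).1⟩

/-- THE REPAIRED CRUX SHAPE the invariant suggests (planners' call; recorded here so the pointwise layer has a consumer):
the crux's body under the extra hypothesis `SimplyConnectedSpace G` follows from symmetric-torus zero-freeness under the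
same hypothesis (sorry-free; STUB TA landed). -/
theorem freeEnergyWindowChannelSC_of_torusZeroFreeSC
    (hT : ∀ (G : Type) [Group G] [TopologicalSpace G] [IsTopologicalGroup G] [CompactSpace G] [MeasurableSpace G] [BorelSpace G], Literature.MathematicalPhysics.QuantumFieldTheory.IsCompactSimpleLieGroup G → SimplyConnectedSpace G → ∀ r : Literature.MathematicalPhysics.QuantumFieldTheory.LatticeRep G,
      ∃ β₁ : ℝ, ∀ β : ℝ, β₁ ≤ β → ∀ ρ : ℝ, 0 < ρ →
        ∃ D : Set ℂ, IsOpen D ∧ IsConnected D ∧ (β : ℂ) ∈ D ∧ (∃ x : ℝ, |x| < ρ ∧ (x : ℂ) ∈ D) ∧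
          ∃ P₀ : ℕ, ∀ P : ℕ, P₀ ≤ P → ∀ z ∈ D,
            Literature.MathematicalPhysics.QuantumFieldTheory.wilsonFinTorusPartitionC r.ρ z P P P P ≠ 0) :
    ∀ (G : Type) [Group G] [TopologicalSpace G] [IsTopologicalGroup G] [CompactSpace G] [MeasurableSpace G] [BorelSpace G], Literature.MathematicalPhysics.QuantumFieldTheory.IsCompactSimpleLieGroup G → SimplyConnectedSpace G → ∀ r : Literature.MathematicalPhysics.QuantumFieldTheory.LatticeRep G,
      ∃ β₁ : ℝ, ∀ β : ℝ, β₁ ≤ β → ∀ ρ : ℝ, 0 < ρ →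
        ∃ D : Set ℂ, IsOpen D ∧ IsConnected D ∧ (β : ℂ) ∈ D ∧ (∃ x : ℝ, |x| < ρ ∧ (x : ℂ) ∈ D) ∧
          ∃ f : ℂ → ℂ, DifferentiableOn ℂ f D ∧ ∃ M : ℝ, ∃ P₀ : ℕ, ∀ P : ℕ, P₀ ≤ P → ∀ z ∈ D,
            Literature.MathematicalPhysics.QuantumFieldTheory.wilsonFinTorusPartitionC r.ρ z P P P P ≠ 0 ∧
              |Real.log ‖Literature.MathematicalPhysics.QuantumFieldTheory.wilsonFinTorusPartitionC r.ρ z P P P P‖ +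
                (P : ℝ) ^ 4 * (f z).re| ≤ M := by
  intro G _ _ _ _ _ _ hG hsc r
  obtain ⟨β₁, hβ₁⟩ := hT G hG hsc r
  exact ⟨β₁, fun β hβ =>
    Summit.QuantumFields.YangMills.Theorems.FreeEnergyWindowChannel.stub_transportAt G hG r β (hβ₁ β hβ)⟩


/-! ## Layer 5 (lead c3): self-improvement — the window is exponentially thin

The crux's window constant `M` is idle: along any window channel the remainder `u_P = log ‖Z_P‖ + P⁴ Re f` is pinned
to `A e^{-(c/2)P}` near the anchor point `x` (Archimedean step, as in layer 3) and the landed real-part two-constants chain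
`stub_reChain` (exponent `θ` and constant `C₀` UNIFORM on a compact `K ⊆ D`) gives `|u_P| ≤ C₀ Aᶿ B^{1-θ} e^{-(cθ/2)P}` on
`K`; shrinking the channel to an open connected `D' ∋ x, β` with `D' ⊆ K ⊆ D` (`stub_connectedCompactJoin`, landed p146690)
turns the bounded window into an exponential one.  So `FreeEnergyWindowChannel` is EQUIVALENT to its exponential form, and
at real `β` it yields `|log Z(β;P⁴) + P⁴ F| ≤ e^{-cP}` — the torus ("thermal/Casimir") input of `HarmonicMeasureEngine`. -/

/-- STUB X1 — LANDED (p161803, wave 4, `Theorems/…StubExpDecayOnCompacts.lean`; tree copy below).  Pinned windows decay EXPONENTIALLY on compacts: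
`Z_P` entire, `f` holomorphic on an open preconnected `D`, window `Z_P ≠ 0 ∧ |log ‖Z_P‖ + P⁴ Re f| ≤ M` on `D` for
`P ≥ P₀`, and the same quantity `≤ A e^{-aP}` on `D ∩ {dist · x < r₀}`; then on every compact `K ⊆ D` it is `≤ e^{-cP}` for
some `c > 0` and all large `P` (`stub_reChain` on `K`: `|u_P| ≤ C₀ (A e^{-aP})^θ (max M 1)^{1-θ}`, then absorb the constant
into half the rate). -/
theorem stub_expDecayOnCompacts :
    ∀ (Z : ℕ → ℂ → ℂ) (D : Set ℂ), IsOpen D → IsPreconnected D → (∀ P : ℕ, Differentiable ℂ (Z P)) →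
      ∀ x ∈ D, ∀ r₀ : ℝ, 0 < r₀ → ∀ f : ℂ → ℂ, DifferentiableOn ℂ f D → ∀ (M : ℝ) (P₀ : ℕ),
      (∀ P : ℕ, P₀ ≤ P → ∀ z ∈ D, Z P z ≠ 0 ∧ |Real.log ‖Z P z‖ + (P : ℝ) ^ 4 * (f z).re| ≤ M) →
      ∀ A a : ℝ, 0 < A → 0 < a →
      (∀ P : ℕ, P₀ ≤ P → ∀ z ∈ D, dist z x < r₀ → |Real.log ‖Z P z‖ + (P : ℝ) ^ 4 * (f z).re| ≤ A * Real.exp (-(a * P))) →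
      ∀ K : Set ℂ, IsCompact K → K ⊆ D →
        ∃ c : ℝ, 0 < c ∧ ∃ P₁ : ℕ, ∀ P : ℕ, P₁ ≤ P → ∀ z ∈ K,
          |Real.log ‖Z P z‖ + (P : ℝ) ^ 4 * (f z).re| ≤ Real.exp (-(c * P)) :=
  Summit.QuantumFields.YangMills.Theorems.FreeEnergyWindowChannel.stub_expDecayOnCompacts

/-- STUB X2 — LANDED (p162102, lead, `Theorems/…StubExpWindowAt.lean`; tree copy below).  At a fixed admissible `(G, r)` and real `β`: window
channels at `β` for every `ρ` ⇒ EXPONENTIAL window channels at `β` for every `ρ` (anchor pinning near `x` + STUB X1 on the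
compact of `stub_connectedCompactJoin` + restriction of `f` to the sub-channel). -/
theorem stub_expWindowAt :
    ∀ (G : Type) [Group G] [TopologicalSpace G] [IsTopologicalGroup G] [CompactSpace G] [MeasurableSpace G] [BorelSpace G], Literature.MathematicalPhysics.QuantumFieldTheory.IsCompactSimpleLieGroup G → ∀ r : Literature.MathematicalPhysics.QuantumFieldTheory.LatticeRep G, ∀ β : ℝ,
      (∀ ρ : ℝ, 0 < ρ →
        ∃ D : Set ℂ, IsOpen D ∧ IsConnected D ∧ (β : ℂ) ∈ D ∧ (∃ x : ℝ, |x| < ρ ∧ (x : ℂ) ∈ D) ∧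
          ∃ f : ℂ → ℂ, DifferentiableOn ℂ f D ∧ ∃ M : ℝ, ∃ P₀ : ℕ, ∀ P : ℕ, P₀ ≤ P → ∀ z ∈ D,
            Literature.MathematicalPhysics.QuantumFieldTheory.wilsonFinTorusPartitionC r.ρ z P P P P ≠ 0 ∧
              |Real.log ‖Literature.MathematicalPhysics.QuantumFieldTheory.wilsonFinTorusPartitionC r.ρ z P P P P‖ +
                (P : ℝ) ^ 4 * (f z).re| ≤ M) →
      ∀ ρ : ℝ, 0 < ρ →
        ∃ D : Set ℂ, IsOpen D ∧ IsConnected D ∧ (β : ℂ) ∈ D ∧ (∃ x : ℝ, |x| < ρ ∧ (x : ℂ) ∈ D) ∧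
          ∃ f : ℂ → ℂ, DifferentiableOn ℂ f D ∧ ∃ c : ℝ, 0 < c ∧ ∃ P₀ : ℕ, ∀ P : ℕ, P₀ ≤ P → ∀ z ∈ D,
            Literature.MathematicalPhysics.QuantumFieldTheory.wilsonFinTorusPartitionC r.ρ z P P P P ≠ 0 ∧
              |Real.log ‖Literature.MathematicalPhysics.QuantumFieldTheory.wilsonFinTorusPartitionC r.ρ z P P P P‖ +
                (P : ℝ) ^ 4 * (f z).re| ≤ Real.exp (-(c * P)) :=
  Summit.QuantumFields.YangMills.Theorems.FreeEnergyWindowChannel.stub_expWindowAt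

/-- COMPOSITION (sorry-free; STUB X2 landed): **the crux is equivalent to its exponential form** `ExpWindowChannel`
(`→`: STUB X2 at every `β ≥ β₁`; `←`: `e^{-cP} ≤ 1 =: M`). -/
theorem freeEnergyWindowChannel_iff_expWindowChannel :
    Summit.QuantumFields.YangMills.Theses.ComplexCouplingChannel.FreeEnergyWindowChannel ↔
    ∀ (G : Type) [Group G] [TopologicalSpace G] [IsTopologicalGroup G] [CompactSpace G] [MeasurableSpace G] [BorelSpace G], Literature.MathematicalPhysics.QuantumFieldTheory.IsCompactSimpleLieGroup G → ∀ r : Literature.MathematicalPhysics.QuantumFieldTheory.LatticeRep G,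
      ∃ β₁ : ℝ, ∀ β : ℝ, β₁ ≤ β → ∀ ρ : ℝ, 0 < ρ →
        ∃ D : Set ℂ, IsOpen D ∧ IsConnected D ∧ (β : ℂ) ∈ D ∧ (∃ x : ℝ, |x| < ρ ∧ (x : ℂ) ∈ D) ∧
          ∃ f : ℂ → ℂ, DifferentiableOn ℂ f D ∧ ∃ c : ℝ, 0 < c ∧ ∃ P₀ : ℕ, ∀ P : ℕ, P₀ ≤ P → ∀ z ∈ D,
            Literature.MathematicalPhysics.QuantumFieldTheory.wilsonFinTorusPartitionC r.ρ z P P P P ≠ 0 ∧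
              |Real.log ‖Literature.MathematicalPhysics.QuantumFieldTheory.wilsonFinTorusPartitionC r.ρ z P P P P‖ +
                (P : ℝ) ^ 4 * (f z).re| ≤ Real.exp (-(c * P)) := by
  constructor
  · intro h G _ _ _ _ _ _ hG r
    obtain ⟨β₁, hβ₁⟩ := h G hG r
    exact ⟨β₁, fun β hβ => stub_expWindowAt G hG r β (hβ₁ β hβ)⟩
  · intro h G _ _ _ _ _ _ hG r
    obtain ⟨β₁, hβ₁⟩ := h G hG r
    refine ⟨β₁, fun β hβ ρ hρ => ?_⟩
    obtain ⟨D, hDo, hDc, hβD, hx, f, hf, c, hc, P₀, hwin⟩ := hβ₁ β hβ ρ hρ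
    refine ⟨D, hDo, hDc, hβD, hx, f, hf, 1, P₀, fun P hP z hz => ⟨(hwin P hP z hz).1, (hwin P hP z hz).2.trans ?_⟩⟩
    rw [Real.exp_le_one_iff]
    nlinarith [hc, (Nat.cast_nonneg P : (0 : ℝ) ≤ P)]

/-- CONSEQUENCE at real coupling (sorry-free; cf. the engine prover's pointwise `torusFreeEnergy_expSmall_of_anchor_of_window`): **the exponential torus remainder** — under the crux, for
every admissible `(G, r)`, beyond `β₁`, at every real `β ≥ β₁` some real `F` (the bulk free-energy density) has
`|log Z(β; P⁴) + P⁴ F| ≤ e^{-cP}` for all large `P`.  This is the torus ("thermal/Casimir") input of the route's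
`HarmonicMeasureEngine` (stmt-QuantumFields-18844), paid here by crux 18842 ALONE. -/
theorem expTorusRemainder_of_freeEnergyWindowChannel
    (h : Summit.QuantumFields.YangMills.Theses.ComplexCouplingChannel.FreeEnergyWindowChannel) :
    ∀ (G : Type) [Group G] [TopologicalSpace G] [IsTopologicalGroup G] [CompactSpace G] [MeasurableSpace G] [BorelSpace G], Literature.MathematicalPhysics.QuantumFieldTheory.IsCompactSimpleLieGroup G → ∀ r : Literature.MathematicalPhysics.QuantumFieldTheory.LatticeRep G,
      ∃ β₁ : ℝ, ∀ β : ℝ, β₁ ≤ β → ∃ F : ℝ, ∃ c : ℝ, 0 < c ∧ ∃ P₀ : ℕ, ∀ P : ℕ, P₀ ≤ P →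
        |Real.log (Literature.MathematicalPhysics.QuantumFieldTheory.wilsonFinTorusPartition r.ρ β P P P P) +
          (P : ℝ) ^ 4 * F| ≤ Real.exp (-(c * P)) := by
  intro G _ _ _ _ _ _ hG r
  haveI : SecondCountableTopology G :=
    (r.continuous.isClosedEmbedding r.injective).isEmbedding.secondCountableTopology
  obtain ⟨β₁, hβ₁⟩ := (freeEnergyWindowChannel_iff_expWindowChannel.1 h) G hG r
  refine ⟨β₁, fun β hβ => ?_⟩
  obtain ⟨D, -, -, hβD, -, f, -, c, hc, P₀, hwin⟩ := hβ₁ β hβ 1 one_pos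
  refine ⟨(f β).re, c, hc, P₀, fun P hP => ?_⟩
  have hnorm : ‖Literature.MathematicalPhysics.QuantumFieldTheory.wilsonFinTorusPartitionC r.ρ (β : ℂ) P P P P‖ =
      Literature.MathematicalPhysics.QuantumFieldTheory.wilsonFinTorusPartition r.ρ β P P P P := by
    rw [Literature.MathematicalPhysics.QuantumFieldTheory.wilsonFinTorusPartitionC_ofReal, Complex.norm_real,
      Real.norm_eq_abs, abs_of_pos
        (Literature.MathematicalPhysics.QuantumFieldTheory.wilsonFinTorusPartition_pos r.continuous β P P P P)]
  have := (hwin P hP (β : ℂ) hβD).2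
  rwa [hnorm] at this

/-- NEGATIVE LEMMA with the WEAKER hypothesis (sorry-free): if for some admissible `(G, r)`, at
arbitrarily large real `β`, for every real `F` and every rate `c > 0` the remainder `|log Z(β;P⁴) + P⁴F|` exceeds
`e^{-cP}` for infinitely many `P`, the crux is false. -/
theorem not_FreeEnergyWindowChannel_of_notExpTorusRemainder
    (G : Type) [Group G] [TopologicalSpace G] [IsTopologicalGroup G] [CompactSpace G] [MeasurableSpace G]
    [BorelSpace G] (hG : Literature.MathematicalPhysics.QuantumFieldTheory.IsCompactSimpleLieGroup G)
    (r : Literature.MathematicalPhysics.QuantumFieldTheory.LatticeRep G)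
    (hκ : ∀ b : ℝ, ∃ β : ℝ, b ≤ β ∧ ∀ F : ℝ, ∀ c : ℝ, 0 < c → ∀ P₀ : ℕ, ∃ P : ℕ, P₀ ≤ P ∧
      Real.exp (-(c * P)) <
        |Real.log (Literature.MathematicalPhysics.QuantumFieldTheory.wilsonFinTorusPartition r.ρ β P P P P) +
          (P : ℝ) ^ 4 * F|) :
    ¬ Summit.QuantumFields.YangMills.Theses.ComplexCouplingChannel.FreeEnergyWindowChannel := by
  intro h
  obtain ⟨β₁, hβ₁⟩ := expTorusRemainder_of_freeEnergyWindowChannel h G hG r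
  obtain ⟨β, hb, hno⟩ := hκ β₁
  obtain ⟨F, c, hc, P₀, hP₀⟩ := hβ₁ β hb
  obtain ⟨P, hP, hlt⟩ := hno F c hc P₀
  exact (not_lt.2 (hP₀ P hP)) hlt

/-- STUB X4 — LANDED (p161927, wave 4, `Theorems/…StubFreeEnergyAnalytic.lean`; tree copy below).  Under the crux, for every admissible `(G, r)` the bulk
free-energy density `F(β) = -lim_P P⁻⁴ log Z(β; P⁴)` EXISTS at every `β ≥ β₁` and is REAL-ANALYTIC on `[β₁, ∞)` (no bulk
phase transition of any order at large coupling): the window at `(β, 1)` gives `P⁻⁴ log Z_P(t) → -Re f(t)` for real `t`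
near `β`, and `t ↦ Re f(t)` is real-analytic (`f` holomorphic).  No anchor and no transport are needed. -/
theorem stub_freeEnergyAnalytic :
    Summit.QuantumFields.YangMills.Theses.ComplexCouplingChannel.FreeEnergyWindowChannel →
    ∀ (G : Type) [Group G] [TopologicalSpace G] [IsTopologicalGroup G] [CompactSpace G] [MeasurableSpace G] [BorelSpace G], Literature.MathematicalPhysics.QuantumFieldTheory.IsCompactSimpleLieGroup G → ∀ r : Literature.MathematicalPhysics.QuantumFieldTheory.LatticeRep G,
      ∃ β₁ : ℝ, ∃ F : ℝ → ℝ, AnalyticOnNhd ℝ F (Set.Ici β₁) ∧ ∀ β : ℝ, β₁ ≤ β →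
        Filter.Tendsto (fun P : ℕ => -(((P : ℝ) ^ 4)⁻¹ *
          Real.log (Literature.MathematicalPhysics.QuantumFieldTheory.wilsonFinTorusPartition r.ρ β P P P P)))
          Filter.atTop (nhds (F β)) :=
  Summit.QuantumFields.YangMills.Theorems.FreeEnergyWindowChannel.stub_freeEnergyAnalytic

/-! ## Layer 6 (lead c3): the regime split is lossless — crux ⇔ REACH ∧ LOCAL ⇔ REACH ∧ CUMULANT RADIUS

Layer 2 glued REACH (`stub_torusZeroFreeReach`) and LOCAL zero-free discs (from the cumulant radius K through the landed
bridge) into T ⇔ crux.  Conversely the crux implies each piece: REACH (join the crux's zero-free channel at `max b β₁` to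
the anchor's zero-free disc `‖z‖ < ρ₀` through the common real point `x`), LOCAL (an open zero-free set around `t` contains
a disc) and K (the bounded window on a disc around a real `t` bounds, by Borel–Carathéodory and Cauchy's estimates, all
derivatives of a holomorphic branch of `log Z_P + P⁴ f` at `t` by `C_M n! (4/δ)ⁿ` uniformly in `P`, and `f`'s by Cauchy;
at real `s` the real part of the branch is `log Z_ℝ(s; P⁴)`).  So re-lining the crux on REACH ∧ K (leads c1/c2) loses
nothing. -/

/-- STUB Y1 — LANDED (p162601, wave 5, `Theorems/…StubReachOfCrux.lean`; tree copy below).  crux ⇒ REACH: under the crux, for every admissible `(G, r)` and every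
threshold `b` some `βs ≥ b` is joined to `0` by an open connected channel on which `Z_P`, `P ≥ P₀`, has no zeros
(the crux's channel at `(max b β₁, ρ₀)` united with the anchor's zero-free disc `ball 0 ρ₀`, which meet at the real point
`x`). -/
theorem stub_reach_of_crux :
    Summit.QuantumFields.YangMills.Theses.ComplexCouplingChannel.FreeEnergyWindowChannel →
    ∀ (G : Type) [Group G] [TopologicalSpace G] [IsTopologicalGroup G] [CompactSpace G] [MeasurableSpace G] [BorelSpace G], Literature.MathematicalPhysics.QuantumFieldTheory.IsCompactSimpleLieGroup G → ∀ r : Literature.MathematicalPhysics.QuantumFieldTheory.LatticeRep G,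
    ∀ b : ℝ, ∃ βs : ℝ, b ≤ βs ∧ ∃ D : Set ℂ, IsOpen D ∧ IsConnected D ∧ (0 : ℂ) ∈ D ∧ ((βs : ℝ) : ℂ) ∈ D ∧
      ∃ P₀ : ℕ, ∀ P : ℕ, P₀ ≤ P → ∀ z ∈ D,
        Literature.MathematicalPhysics.QuantumFieldTheory.wilsonFinTorusPartitionC r.ρ z P P P P ≠ 0 :=
  Summit.QuantumFields.YangMills.Theorems.FreeEnergyWindowChannel.stub_reach_of_crux

/-- crux ⇒ LOCAL (sorry-free): the crux's zero-free open channel at `(t, 1)` contains a disc around `t`. -/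
theorem local_of_crux
    (h : Summit.QuantumFields.YangMills.Theses.ComplexCouplingChannel.FreeEnergyWindowChannel) :
    ∀ (G : Type) [Group G] [TopologicalSpace G] [IsTopologicalGroup G] [CompactSpace G] [MeasurableSpace G] [BorelSpace G], Literature.MathematicalPhysics.QuantumFieldTheory.IsCompactSimpleLieGroup G → ∀ r : Literature.MathematicalPhysics.QuantumFieldTheory.LatticeRep G,
      ∃ β₁ : ℝ, ∀ t : ℝ, β₁ ≤ t → ∃ δ : ℝ, 0 < δ ∧ ∃ P₀ : ℕ, ∀ P : ℕ, P₀ ≤ P → ∀ z ∈ Metric.ball ((t : ℝ) : ℂ) δ,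
        Literature.MathematicalPhysics.QuantumFieldTheory.wilsonFinTorusPartitionC r.ρ z P P P P ≠ 0 := by
  intro G _ _ _ _ _ _ hG r
  obtain ⟨β₁, hβ₁⟩ := Summit.QuantumFields.YangMills.Theorems.FreeEnergyWindowChannel.torusZeroFree_of_crux h G hG r
  refine ⟨β₁, fun t ht => ?_⟩
  obtain ⟨D, hDo, -, htD, -, P₀, hZ⟩ := hβ₁ t ht 1 one_pos
  obtain ⟨δ, hδ, hball⟩ := Metric.isOpen_iff.1 hDo (t : ℂ) htD
  exact ⟨δ, hδ, P₀, fun P hP z hz => hZ P hP z (hball hz)⟩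

/-- STUB Y2 — LANDED (p162813, wave 5, `Theorems/…StubCumulantRadiusOfCrux.lean`; tree copy below).  crux ⇒ CUMULANT RADIUS: under the crux, for every admissible `(G, r)`, beyond `β₁`, at
every real `t ≥ β₁` the derivatives of the finite-volume free energies `s ↦ log Z_ℝ(s; P⁴)` at `t` grow at most
geometrically, `|∂ⁿ log Z_P(t)| ≤ K_P n! Cⁿ` (`n ≥ 1`, `P ≥ P₀`), with `C` UNIFORM in `P` (bounded window `|Re φ_P| ≤ M` for
the holomorphic `φ_P = log Z_P + P⁴ f` on a disc `ball t δ ⊆ D` ⇒ Borel–Carathéodory ⇒ Cauchy ⇒ `‖φ_P⁽ⁿ⁾(t)‖ ≤ 4M n! (4/δ)ⁿ`;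
Cauchy for `f` on the disc; `∂ⁿ log Z_ℝ(·;P⁴)(t) = Re (log Z_P)⁽ⁿ⁾(t)`). -/
theorem stub_cumulantRadius_of_crux :
    Summit.QuantumFields.YangMills.Theses.ComplexCouplingChannel.FreeEnergyWindowChannel →
    ∀ (G : Type) [Group G] [TopologicalSpace G] [IsTopologicalGroup G] [CompactSpace G] [MeasurableSpace G] [BorelSpace G], Literature.MathematicalPhysics.QuantumFieldTheory.IsCompactSimpleLieGroup G → ∀ r : Literature.MathematicalPhysics.QuantumFieldTheory.LatticeRep G,
    ∃ β₁ : ℝ, ∀ t : ℝ, β₁ ≤ t → ∃ C : ℝ, 0 < C ∧ ∃ P₀ : ℕ, ∀ P : ℕ, P₀ ≤ P → ∃ K : ℝ, ∀ n : ℕ, 1 ≤ n →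
      |iteratedDeriv n (fun s : ℝ =>
          Real.log (Literature.MathematicalPhysics.QuantumFieldTheory.wilsonFinTorusPartition r.ρ s P P P P)) t| ≤
        K * n.factorial * C ^ n :=
  Summit.QuantumFields.YangMills.Theorems.FreeEnergyWindowChannel.stub_cumulantRadius_of_crux

/-- LOCAL zero-free discs from a cumulant-radius HYPOTHESIS (sorry-free; the hypothesis form of
`torusZeroFreeLocal_of_cumulantRadius`, through the landed bridge `stub_zeroFreeOfDerivBounds`). -/
theorem local_of_cumulantRadius
    (hK : ∀ (G : Type) [Group G] [TopologicalSpace G] [IsTopologicalGroup G] [CompactSpace G] [MeasurableSpace G] [BorelSpace G], Literature.MathematicalPhysics.QuantumFieldTheory.IsCompactSimpleLieGroup G → ∀ r : Literature.MathematicalPhysics.QuantumFieldTheory.LatticeRep G,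
      ∃ β₁ : ℝ, ∀ t : ℝ, β₁ ≤ t → ∃ C : ℝ, 0 < C ∧ ∃ P₀ : ℕ, ∀ P : ℕ, P₀ ≤ P → ∃ K : ℝ, ∀ n : ℕ, 1 ≤ n →
        |iteratedDeriv n (fun s : ℝ =>
            Real.log (Literature.MathematicalPhysics.QuantumFieldTheory.wilsonFinTorusPartition r.ρ s P P P P)) t| ≤
          K * n.factorial * C ^ n) :
    ∀ (G : Type) [Group G] [TopologicalSpace G] [IsTopologicalGroup G] [CompactSpace G] [MeasurableSpace G] [BorelSpace G], Literature.MathematicalPhysics.QuantumFieldTheory.IsCompactSimpleLieGroup G → ∀ r : Literature.MathematicalPhysics.QuantumFieldTheory.LatticeRep G,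
      ∃ β₁ : ℝ, ∀ t : ℝ, β₁ ≤ t → ∃ δ : ℝ, 0 < δ ∧ ∃ P₀ : ℕ, ∀ P : ℕ, P₀ ≤ P → ∀ z ∈ Metric.ball ((t : ℝ) : ℂ) δ,
        Literature.MathematicalPhysics.QuantumFieldTheory.wilsonFinTorusPartitionC r.ρ z P P P P ≠ 0 := by
  intro G _ _ _ _ _ _ hG r
  haveI : SecondCountableTopology G :=
    (r.continuous.isClosedEmbedding r.injective).isEmbedding.secondCountableTopology
  obtain ⟨β₁, hKt⟩ := hK G hG r
  refine ⟨β₁, fun t ht => ?_⟩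
  obtain ⟨C, hC, P₀, hP₀⟩ := hKt t ht
  refine ⟨C⁻¹, inv_pos.2 hC, P₀, fun P hP z hz => ?_⟩
  obtain ⟨K, hKn⟩ := hP₀ P hP
  set Z : ℂ → ℂ := fun w =>
    Literature.MathematicalPhysics.QuantumFieldTheory.wilsonFinTorusPartitionC r.ρ w P P P P with hZ
  have hZd : Differentiable ℂ Z :=
    Literature.MathematicalPhysics.QuantumFieldTheory.differentiable_wilsonFinTorusPartitionC r.ρ r.continuous P P P P
  have hnorm : ∀ s : ℝ, ‖Z (s : ℂ)‖ =
      Literature.MathematicalPhysics.QuantumFieldTheory.wilsonFinTorusPartition r.ρ s P P P P := fun s => by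
    simp only [hZ, Literature.MathematicalPhysics.QuantumFieldTheory.wilsonFinTorusPartitionC_ofReal, Complex.norm_real,
      Real.norm_eq_abs]
    exact abs_of_pos
      (Literature.MathematicalPhysics.QuantumFieldTheory.wilsonFinTorusPartition_pos r.continuous s P P P P)
  have hreal : ∀ s : ℝ, Z (s : ℂ) = ((‖Z (s : ℂ)‖ : ℝ) : ℂ) := fun s => by
    rw [hnorm s]
    simp only [hZ, Literature.MathematicalPhysics.QuantumFieldTheory.wilsonFinTorusPartitionC_ofReal]
  have hne : ∀ s : ℝ, Z (s : ℂ) ≠ 0 := fun s => by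
    rw [hreal s, Ne, Complex.ofReal_eq_zero, hnorm s]
    exact (Literature.MathematicalPhysics.QuantumFieldTheory.wilsonFinTorusPartition_pos r.continuous s P P P P).ne'
  have hder : ∀ n : ℕ, 1 ≤ n → |iteratedDeriv n (fun s : ℝ => Real.log ‖Z (s : ℂ)‖) t| ≤ K * n.factorial * C ^ n := by
    intro n hn
    have hfun : (fun s : ℝ => Real.log ‖Z (s : ℂ)‖) = fun s : ℝ =>
        Real.log (Literature.MathematicalPhysics.QuantumFieldTheory.wilsonFinTorusPartition r.ρ s P P P P) :=
      funext fun s => by rw [hnorm s]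
    rw [hfun]
    exact hKn n hn
  have hzt : ‖z - (t : ℂ)‖ < C⁻¹ := by rwa [Metric.mem_ball, dist_eq_norm] at hz
  exact Summit.QuantumFields.YangMills.Theorems.FreeEnergyWindowChannel.stub_zeroFreeOfDerivBounds Z t C K hC hZd hreal hne
    hder z hzt

/-- COMPOSITION (sorry-free; landed in `Theorems/…Structure.lean`, p163100): **crux ⇔ REACH ∧ LOCAL** (`→`: Y1 and `local_of_crux`; `←`: the landed regime
glue `stub_torusZeroFreeRegime` and the transport criterion). -/
theorem freeEnergyWindowChannel_iff_reach_and_local :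
    Summit.QuantumFields.YangMills.Theses.ComplexCouplingChannel.FreeEnergyWindowChannel ↔
    ((∀ (G : Type) [Group G] [TopologicalSpace G] [IsTopologicalGroup G] [CompactSpace G] [MeasurableSpace G] [BorelSpace G], Literature.MathematicalPhysics.QuantumFieldTheory.IsCompactSimpleLieGroup G → ∀ r : Literature.MathematicalPhysics.QuantumFieldTheory.LatticeRep G,
      ∀ b : ℝ, ∃ βs : ℝ, b ≤ βs ∧ ∃ D : Set ℂ, IsOpen D ∧ IsConnected D ∧ (0 : ℂ) ∈ D ∧ ((βs : ℝ) : ℂ) ∈ D ∧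
        ∃ P₀ : ℕ, ∀ P : ℕ, P₀ ≤ P → ∀ z ∈ D,
          Literature.MathematicalPhysics.QuantumFieldTheory.wilsonFinTorusPartitionC r.ρ z P P P P ≠ 0) ∧
    (∀ (G : Type) [Group G] [TopologicalSpace G] [IsTopologicalGroup G] [CompactSpace G] [MeasurableSpace G] [BorelSpace G], Literature.MathematicalPhysics.QuantumFieldTheory.IsCompactSimpleLieGroup G → ∀ r : Literature.MathematicalPhysics.QuantumFieldTheory.LatticeRep G,
      ∃ β₁ : ℝ, ∀ t : ℝ, β₁ ≤ t → ∃ δ : ℝ, 0 < δ ∧ ∃ P₀ : ℕ, ∀ P : ℕ, P₀ ≤ P → ∀ z ∈ Metric.ball ((t : ℝ) : ℂ) δ,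
        Literature.MathematicalPhysics.QuantumFieldTheory.wilsonFinTorusPartitionC r.ρ z P P P P ≠ 0)) :=
  ⟨fun h => ⟨stub_reach_of_crux h, local_of_crux h⟩, fun h =>
    Summit.QuantumFields.YangMills.Theorems.FreeEnergyWindowChannel.stub_transportCriterion.2
      (Summit.QuantumFields.YangMills.Theorems.FreeEnergyWindowChannel.stub_torusZeroFreeRegime h.1 h.2)⟩

/-- COMPOSITION (sorry-free; landed in `Theorems/…Structure.lean`, p163100): **crux ⇔ REACH ∧ CUMULANT RADIUS** — the layer-2 regime split of the crux
into a global zero-freeness piece and a real-variable weak-coupling piece is an EQUIVALENCE. -/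
theorem freeEnergyWindowChannel_iff_reach_and_cumulantRadius :
    Summit.QuantumFields.YangMills.Theses.ComplexCouplingChannel.FreeEnergyWindowChannel ↔
    ((∀ (G : Type) [Group G] [TopologicalSpace G] [IsTopologicalGroup G] [CompactSpace G] [MeasurableSpace G] [BorelSpace G], Literature.MathematicalPhysics.QuantumFieldTheory.IsCompactSimpleLieGroup G → ∀ r : Literature.MathematicalPhysics.QuantumFieldTheory.LatticeRep G,
      ∀ b : ℝ, ∃ βs : ℝ, b ≤ βs ∧ ∃ D : Set ℂ, IsOpen D ∧ IsConnected D ∧ (0 : ℂ) ∈ D ∧ ((βs : ℝ) : ℂ) ∈ D ∧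
        ∃ P₀ : ℕ, ∀ P : ℕ, P₀ ≤ P → ∀ z ∈ D,
          Literature.MathematicalPhysics.QuantumFieldTheory.wilsonFinTorusPartitionC r.ρ z P P P P ≠ 0) ∧
    (∀ (G : Type) [Group G] [TopologicalSpace G] [IsTopologicalGroup G] [CompactSpace G] [MeasurableSpace G] [BorelSpace G], Literature.MathematicalPhysics.QuantumFieldTheory.IsCompactSimpleLieGroup G → ∀ r : Literature.MathematicalPhysics.QuantumFieldTheory.LatticeRep G,
      ∃ β₁ : ℝ, ∀ t : ℝ, β₁ ≤ t → ∃ C : ℝ, 0 < C ∧ ∃ P₀ : ℕ, ∀ P : ℕ, P₀ ≤ P → ∃ K : ℝ, ∀ n : ℕ, 1 ≤ n →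
        |iteratedDeriv n (fun s : ℝ =>
            Real.log (Literature.MathematicalPhysics.QuantumFieldTheory.wilsonFinTorusPartition r.ρ s P P P P)) t| ≤
          K * n.factorial * C ^ n)) :=
  ⟨fun h => ⟨stub_reach_of_crux h, stub_cumulantRadius_of_crux h⟩, fun h =>
    Summit.QuantumFields.YangMills.Theorems.FreeEnergyWindowChannel.stub_transportCriterion.2
      (Summit.QuantumFields.YangMills.Theorems.FreeEnergyWindowChannel.stub_torusZeroFreeRegime h.1
        (local_of_cumulantRadius h.2))⟩

end Summit.QuantumFields.YangMills.Cruxes.FreeEnergyWindowChannel.Transport
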